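import Mathlib
import HarnessLib
import HarnessLib.Audit
import Summits.Parity.Statement
import Literature.NumberTheory.Sieve.MoebiusShiftedPrimes

/-!
Route: AntipodeTransport

CLOSED (retired) 2026-08-15T14:03:21Z by planner-Parity-route-Parity-AntipodeTransport-0 — reason: not-a-thesis: assembly concludes MoebiusShiftedPrimesConjecture, not GeneralizedHardyLittlewood (route-repair confirms operator audit; cone debt is structural, see note) — note: route-repair (cone) by planner-Parity-route-Parity-AntipodeTransport-0, 2026-08-15: CONFIRMS the operator's D-0027 §2.1 retirement (13:49Z); the work item had been re-opened at 13:55Z with closed_as still = retired. Cone diagnosis of the 6 listed unproved facts: 5 are structural for EVERY route of P. The file is kept as the record of this route; refuted decls are indexed as negative knowledge (`ledger negatives`).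

# Route AntipodeTransport — Parity is the antipode — a log-power Halász bound for e^{iθΩ(p+h)} on
one arc near π transports to μ ⟂ shifted primes by harmonic measure

It suffices to show X = ArcSaving (card parity-antipode-transport, Crux 1, made precise): for every
shift h ≥ 1 and every fixed
progression p ≡ a (mod q) there are an arc [θ₁, θ₀] ⊂ (0, π) and c > 0 with POISSON BUDGET
c·(tan(θ₀/2) − tan(θ₁/2)) > π such
that |Σ_{p ≤ x, p ≡ a (q)} e^{iθΩ(p+h)}| ≤ π(x)(log x)^{−c} uniformly for θ ∈ [θ₁, θ₀], x ≥ x₀ — a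
log-power Halász/Hildebrand
bound for the completely multiplicative unimodular functions g_θ = e^{iθΩ} over shifted primes, on
ONE arc of angles creeping up
to the antipode θ = π (the model size is (log x)^{cos θ − 1}, so the demand is far below the truth;
as θ₀ → π the required c → 0).
The rest of the route is provable now: the polynomial P_x(z) = π(x)^{−1} Σ_p z^{Ω(p+h)} has |P_x| ≤
1 on the unit circle, the graded
growth |P_x(z)| ≤ B(log x)^{|z|−1} on 1 ≤ |z| ≤ 3/2 (Shiu/Pollack-type Brun–Titchmarsh for y^Ω on
shifted primes), and its value
at −1 is the parity atom π(x)^{−1}Σ_p λ(p+h); Poisson–Jensen in the disc plus one sub-mean-value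
circle around −1 (a two-constants
argument with an explicit budget) turn the arc bound into |Σ_{p ≡ a (q)} λ(p+h)| ≤ π(x)(log x)^{−η},
and squarefree sieving gives
Literature.NumberTheory.Sieve.MoebiusShiftedPrimesConjecture (Σ_{p≤X} μ(p+h) = o(π(X)) for all h ≥
1), the m = 1 atom below
MobiusShiftedPrimes' crux stmt-Parity-0612. Like route ShiftedMultiplicationTable the Assembly ends
at that atom; EH ∧ M_avg ⟹ pairs
⟹ DimOne ⟹ GHL is owned by routes MobiusShiftedPrimes and DicksonFibration.
Lean: `∀ h : ℕ, 1 ≤ h → ∀ q : ℕ, 1 ≤ q → ∀ a : ℕ, ∃ θ₁ θ₀ c : ℝ, 0 < θ₁ ∧ θ₁ < θ₀ ∧ θ₀ < Real.pi ∧ 0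
< c ∧ Real.pi < c * (Real.tan (θ₀ / 2) - Real.tan (θ₁ / 2)) ∧ ∃ x₀ : ℕ, ∀ x : ℕ, x₀ ≤ x → ∀ θ : ℝ,
θ₁ ≤ θ → θ ≤ θ₀ → ‖∑ p ∈ (Nat.primesLE x).filter (fun p : ℕ => p ≡ a [MOD q]), Complex.exp
(Complex.I * (θ : ℂ) * ((ArithmeticFunction.cardFactors (p + h) : ℕ) : ℂ))‖ ≤ (Nat.primeCounting x :
ℝ) * Real.log x ^ (-c)`

## Assembly
Composition of the two glue supports and the one-line weakening "(log x)^{−η}-bound ⟹ o(π(x))"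
(checked sorry-free modulo that
weakening as `assembly_of_glue` in the planner's Sketch.lean, rc 0): LiouvilleAtomAP turns the three
hypotheses into the Liouville
atom with a log-power saving in every fixed progression; LiouvilleToMoebius converts it into
Literature.NumberTheory.Sieve.MoebiusShiftedPrimesConjecture. TwoConstantsTransport and
ShiftedPrimeGrowth are provable now, so
the conclusion is conditional on ArcSaving alone. The Assembly ends at the ATOM (μ ⟂ shifted primes
= the m = 1, shift-sign-flipped,
Λ-free case of stmt-Parity-0612), not at Summit.Parity.GeneralizedHardyLittlewood: the continuation
0612 → 0613 (uniformity in
dilations m ≤ x^ε, same lemma applied to f_{x,m}(z) = Σ_{p≡h (m)} z^{Ω((p−h)/m)}) → EH ∧ M_avg ⟹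
PairsHL (MobiusShiftedPrimes.Assembly,
stmt-Parity-0611) → tuples → DimOne → GHL (DicksonFibration) is owned by those routes and is not
re-filed here.

Rationale: WHY THIS LINE. Mechanism: one complex variable ON the parity problem — the parity atom is the value
at the antipode z = −1 of a non-negative-coefficient
polynomial P_x(z) = π(x)^{−1}Σ_p z^{Ω(p+h)} (the characteristic function of the local law of Ω on
shifted primes), log|P_x| is
subharmonic, and its size at −1 is a harmonic-measure budget of its size elsewhere: by
Poisson–Jensen in the unit disc (Ransford1995
Thm 4.5.1, PDF p.92) and the two-constant theorem (Ransford1995 Thm 4.3.7, PDF p.80) a saving (log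
x)^{−c} on an arc pair A and the
graded sieve growth (log x)^{|z|−1} outside the circle give |P_x(−1)| ≤ (log x)^{−η} as soon as
c·κ(A) > 1, κ(A) = (1/π)∫_A|1+e^{iφ}|^{−2}dφ
= (tan(θ₀/2) − tan(θ₁/2))/π (the Poisson kernel AT the antipode, divergent as θ₀ → π; computed here
and independently by the card's
triage refuter). Imported area: potential theory / harmonic measure (complex analysis), pointed at
the multiplicative theory of
shifted primes (Hildebrand1989: partial Halász analogue, |Σ_p g(p+1)| ≤ (1−δ)π(x) for non-torsion g;
Elliott1997; Timofeev's 1994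
survey zbl:0941.11036 names the asymptotics of such means "the main open problem in this area"); the
growth input is Shiu1980-type
(in tree and PROVED: Literature.NumberTheory.Sieve.Shiu1980BrunTitchmarsh_holds;
shifted-prime/sifted form Pollack2019 = doi:10.1017/s0017089519000041,
NairTenenbaum1998). What it does that no prior route does: MobiusShiftedPrimes files the atom with
no engine, ShiftedMultiplicationTable
attacks it by Type-I₂/Type-II dispersion, ParityCorner continues in the RANK variable of Λ_k; this
line quantifies exactly which
strengthening of the Hildebrand–Elliott programme (log-power, uniform on an arc approaching π,
torsion or not) pays for parity, and
makes "parity is isolated 2-torsion" (card parity-is-torsion) false in the analytic sense: the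
antipode is dominated by its neighbours.

RANKED CRUXES. #2 ArcSaving (crux) — card Crux 1 in progressions: for every h ≥ 1, q ≥ 1, a there
exist 0 < θ₁ < θ₀ < π, c > 0 with c(tan(θ₀/2) − tan(θ₁/2)) > π and x₀ such that for x ≥ x₀ and all θ
∈ [θ₁, θ₀], |Σ_{p≤x, p≡a (q)} e^{iθΩ(p+h)}| ≤ π(x)(log x)^{−c} (model: ≍ π(x)(log x)^{cos θ−1}/φ(q),
so any c below 1 − cos θ₁ is consistent; e.g. saving (log x)^{−0.06} on [0.9π, 0.99π], or (log
x)^{−1} on [π/2, 0.85π]). [difficulty: open-problem] (why it might fail: At each fixed θ it is a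
log-power Type-II problem for g_θ=e^{iθΩ} on mn+h — λ's own species (Vaughan: BV part fine, bilinear
part = 2-point Elliott on rank-one AP families); Hildebrand's method gives only 1−δ; duality in θ
alone saves only √loglog x (Parseval).) [Hildebrand1989, Elliott1997, zbl:0941.11036,
doi:10.1007/978-1-4757-4507-8_9, MatomakiRadziwillTao2015, Lichtman2020]
#3 SingleAngleSaving (crux) — log-power Hildebrand at ONE non-torsion angle (the first waypoint; not
used by the Assembly): for every h ≥ 1 and every θ with θ/π irrational there are c > 0, x₀ with
|Σ_{p≤x} e^{iθΩ(p+h)}| ≤ π(x)(log x)^{−c} for x ≥ x₀ (Hildebrand1989, a partial Halász analogue on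
p+1, gives at best |Σ_p g(p+1)| ≤ (1−δ)π(x) under a hypothesis of non-torsion type on the powers of
g — exact hypotheses to be page-verified by the grounder, paper paywalled this session, acq-02496;
g_θ = e^{iθΩ} with θ/π irrational has all powers non-pretentious; torsion angles — cubic parity etc.
— are deliberately excluded). [difficulty: open-problem] (why it might fail: Even o(π(x)) at a
single fixed angle is open (Timofeev 1994: the main open problem); a rate needs Halász over shifted
primes, i.e. Type-II sums Σα_mβ_n e^{iθΩ(mn+h)} with log-power saving, known only on average over h
(Lichtman/MRT) or log-averaged.) [Hildebrand1989, zbl:0941.11036, doi:10.1007/bf02465584,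
Lichtman2020, Tao2016]
#9 TwoConstantsTransport (support) — the transport lemma, pure complex analysis (card Crux 2 with
the sharp budget): for 0 < θ₁ < θ₀ < π, c > 0 with c(tan(θ₀/2) − tan(θ₁/2)) > π there are δ ∈ (0,
1/2], η > 0 and, for every B, an L₀ such that every polynomial P ∈ ℂ[z] with |P| ≤ 1 on |z| = 1,
|P(e^{±iθ})| ≤ L^{−c} for θ ∈ [θ₁, θ₀] and |P(z)| ≤ B·L^{|z|−1} for 1 ≤ |z| ≤ 1+δ satisfies |P(−1)|
≤ L^{−η} (L ≥ L₀). Proof (NOTES): Poisson–Jensen in 𝔻 gives log|P(z)| ≤ −c(log L)·ω(z, A, 𝔻) with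
ω(−1+ρe^{iα}) ≥ ρ(2cos α − ρ)(κ/2)(1 − O(ρ)), κπ = tan(θ₀/2) − tan(θ₁/2); the sub-mean-value
inequality on |z+1| = ρ = δ then gives log|P(−1)| ≤ (ρ/π)(1 − cκ + O(ρ))log L + log⁺B. [difficulty:
L] [Ransford1995, AhlforsCA1979]
#9 ShiftedPrimeGrowth (support) — Brun–Titchmarsh for y^Ω on shifted primes, uniform in 1 ≤ y ≤ 3/2
(card's growth input): for every h ≥ 1 there are B, x₀ with Σ_{p≤x} y^{Ω(p+h)} ≤ B·π(x)(log x)^{y−1}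
for all x ≥ x₀, 1 ≤ y ≤ 3/2. Known theorem (Shiu-type bound over the sifted set {m ≤ x+h : m − h
prime}: ≪ (x/log x)(1/log x)exp(Σ_{ℓ≤x} y/ℓ); Pollack 2020 Thm 1.1 / Nair–Tenenbaum / Timofeev's
Hardy–Ramanujan inequality for shifted primes); Lean route: the in-tree PROVED
Shiu1980BrunTitchmarsh_holds adapted to one removed class per prime, or Mathlib/in-tree Selberg
upper-bound sieve (siftedSum_le_totalMass_div_selbergSum_add_holds) with Shiu for y^Ω in
progressions. [difficulty: L] [Shiu1980, Pollack2019, NairTenenbaum1998, Tenenbaum2015]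
#9 LiouvilleAtomAP (support) — instantiation glue: ArcSaving → TwoConstantsTransport →
ShiftedPrimeGrowth → for every h ≥ 1, q ≥ 1, a there is η > 0 with |Σ_{p≤x, p≡a (q)} λ(p+h)| ≤
π(x)(log x)^{−η} for large x. Proof: P := π(x)^{−1}Σ_{p≤x, p≡a (q)} X^{Ω(p+h)} ∈ ℝ_{≥0}[X], L := log
x; |P| ≤ P(1) ≤ 1 on the circle; the arc bound at −θ is the complex conjugate; the graded growth
follows from ShiftedPrimeGrowth with y = |z| after dropping the congruence by positivity; P(−1) =
π(x)^{−1}Σ (−1)^{Ω(p+h)} = π(x)^{−1}Σ λ(p+h). [difficulty: M] [Ransford1995, Vatwani2016]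
#9 LiouvilleToMoebius (support) — squarefree-sieve glue: if Σ_{p≤x, p≡a (q)} λ(p+h) = o(π(x)) for
all h ≥ 1, q ≥ 1, a, then MoebiusShiftedPrimesConjecture. Proof: μ(n) = λ(n)Σ_{k²∣n} μ(k); Σ_{p≤X}
μ(p+h) = Σ_{k≤K} μ(k) Σ_{p≤X, p≡−h (k²)} λ(p+h) + O(Σ_{k>K} #{p ≤ X : k² ∣ p+h}); each k ≤ K term is
o(π(X)) by hypothesis; the tail is ≪ π(X)/K + X^{3/4} by Brun–Titchmarsh (in tree, proved:
Literature.Barriers.Parity.colCount_le_brunTitchmarsh / card_roughAP_le) for k ≤ X^{1/4} and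
trivially beyond; let K → ∞. [difficulty: M] [Lichtman2020, MurtyVatwani2017, Vatwani2016]

TWO-LAYER PLAN. Foreseen glued splits (k ≤ 3, depth 1), filed only when a crux closes or stalls with
a census: ArcSaving ⇐ TypeIArc (BV-type
distribution of e^{iθΩ} in progressions to level 1/2, uniform in θ — provable: Siegel–Walfisz for
z^Ω via L(s,χ)^z plus large sieve)
→ TypeIIArc (bilinear Σα_mβ_n e^{iθΩ(mn+h)} ≪ ‖α‖‖β‖(MN)^{1/2}(log x)^{−C} uniformly on the arc, M ∈
[x^η, x^{1/2}]) → ArcSaving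
(Vaughan glue); SingleAngleSaving ⇐ HalaszShiftedPrimes (o(π) at one non-torsion angle, Hildebrand's
δ → 1) → RateUpgrade →
SingleAngleSaving; TwoConstantsTransport ⇐ PoissonJensenDisc (Mathlib has Jensen at the centre; the
off-centre Poisson–Jensen
inequality via a disc automorphism) → AntipodeKernelEstimate → TwoConstantsTransport.

KILL CRITERIA. ArcSaving REFUTED for some (h, q, a) — e.g. an Ω(π(x)(log x)^{−ε})-oscillation of Σ_p
e^{iθΩ(p+h)} at angles θ_j → π faster
than the budget allows — closes the route (`close --reason refuted:ArcSaving`); since the transport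
is a theorem, such a refutation
plus MoebiusShiftedPrimesConjecture would exhibit a genuinely new phenomenon (arc-large,
antipode-small), file it loudly.
SingleAngleSaving refuted at some irrational θ/π ⟹ ArcSaving is dead for every arc through θ: close.
TwoConstantsTransport refuted
AS STATED (the sharp constant) ⟹ restate both it and ArcSaving with the budget the refuter's
extremal polynomial allows (pivot, not
close; the one-circle argument with single-radius growth already gives the weaker budget c(tan(θ₀/2)
− tan(θ₁/2)) > π²/2).
ShiftedPrimeGrowth or a glue refuted ⟹ bookkeeping error (normalisation π(x) vs x/log x,
y-uniformity): re-derive and restate.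
MoebiusShiftedPrimesConjecture proved elsewhere (ShiftedMultiplicationTable, MobiusShiftedPrimes) ⟹
close superseded, keeping
TwoConstantsTransport/ShiftedPrimeGrowth as Literature-level deliverables. A proof that ArcSaving
(any arc with budget > 1) is
EQUIVALENT to the atom by a cheap argument demotes the route to 'reformulation' (triage refuter: not
expected — the atom is one
o(1) statement at one angle, ArcSaving a log-power statement on an arc; neither direction is
formal).

NOT DECOMPOSED YET. The BUDGET form of the transport (any Borel set A ⊂ T of angles, condition
(1/π)∫_A c(φ)|1+e^{iφ}|^{−2}dφ > 1 for a saving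
profile c(φ) — lets one excise neighbourhoods of all torsion angles and use savings decaying to 0 at
π slower than (π−θ)); the
Type-I/Type-II split of ArcSaving (two-layer plan); uniformity in dilations m ≤ x^ε (0612 → 0613)
and in the shift h (Siegel
conjunct, as in every fixed-h route); the local-law calibration lemma of the card (a uniform
relative-o(1) bulk local law for
Ω(p+h) already implies the atom — parity-hard, 'do not file as glue'; elementary, file as support if
a seat wants it); kit numerics
(|P_x(e^{iθ})| on a θ-grid for x ≤ 10⁹, h = 2, against (log x)^{cos θ−1}); effective constants (all
Siegel-ineffective downstream).

CHEAPEST FALSIFIER. (i) One page of logic (refuter first): does ArcSaving on SOME arc with budget >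
1 follow formally from the atom Σ_p λ(p+h) = o(π(x))
(or from HL) by partial summation over the level sets {Ω(p+h) = k}? If yes the crux is not
weaker-looking than parity and the route is a
reformulation — expected NO: S(θ) = Σ_p λ(p+h)e^{i(θ−π)Ω(p+h)} needs the atom on each level set with
a rate. (ii) Literature lookup
(zbMATH/S2 were rate-limited this session): a Halász-type theorem Σ_p g(p+a) = o(π(x)) for
unimodular completely multiplicative g with
all powers non-pretentious (Indlekofer–Timofeev 1998/2002 doi:10.1007/978-1-4757-4507-8_9,
doi:10.1007/s00013-002-8271-8,
Stepanauskas 1997 doi:10.1007/bf02465584) would make SingleAngleSaving's o(1) version known and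
sharpen rank 3 to 'rate only'.
(iii) Kit (cheap, not decisive for log powers): |Σ_{p≤x} e^{iθΩ(p+2)}|/π(x) on θ ∈ {0.5π, …, 0.99π},
x = 10⁶…10⁹ against
(log x)^{cos θ−1}: a plateau near π not shrinking with x would warn. Done here: the budget κ is
closed-form (no conformal-map numerics
needed): θ*(c, θ₁) = 2·arctan(π/c + tan(θ₁/2)).

NUMBERS. Budget: κ(θ₁,θ₀) = (tan(θ₀/2) − tan(θ₁/2))/π; threshold c·κ > 1 ⟺ θ₀ > θ*(c,θ₁) =
2arctan(π/c + tan(θ₁/2)). Table: (θ₁, c) = (π/2, 1)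
→ θ* = 0.849π; (2π/3, 1.5) → 0.837π; (0.9π, 0.5) → 0.950π; (0.9π, 0.2) → 0.971π; (0.9π, 0.1) →
0.983π; (0.9π, 0.06) → 0.989π.
Arcs: [0.9π, 0.99π] has κ = 18.25 (needs c > 0.055); [0.8π, 0.95π] κ = 3.07 (c > 0.33); [π/2, 0.85π]
κ = 1.01 (c > 0.99). Model
ceiling c ≤ 1 − cos θ₁ (main term (log x)^{cos θ−1}/|Γ(e^{iθ})|, Selberg1954 / Tenenbaum2015 II.6).
One-circle proof: sharp budget
with GRADED growth (log x)^{|z|−1}; with growth at the single radius 1+δ only the same argument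
needs c·κ > π/2. Known savings over
shifted primes: (1−δ)π(x) for non-torsion g (Hildebrand1989); on h-average Σ_{h≤H}|Σ_p μ(p+h)| ≪
Hπ(X)(log X)^{−1/3+ε}, H = X^θ
(Lichtman2020 Thm 1.1, tree lichtman2020_moebius_shifted_primes_avg_power); pointwise in h: nothing
beyond 1−δ. Items at open: 7
(2 cruxes, 4 support, 1 assembly).

DEFINITION REQUESTS. None for Lean notions (Nat.primesLE, Nat.primeCounting,
ArithmeticFunction.cardFactors/liouville, Polynomial.eval, Real.tan,
Irrational are Mathlib; MoebiusShiftedPrimesConjecture is Literature.NumberTheory.Sieve). Cite fact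
wanted (not load-bearing, the
support item is stated to be proved from scratch): Pollack 2020 Glasgow Math. J. 62 Thm 1.1
(doi:10.1017/s0017089519000041,
paywalled — WANTED filed) = Shiu's theorem on sifted sets; bib entries Ransford1995, Pollack2019
submitted this session.

Novelty: Searches (2026-08-15): lit search "multiplicative functions on shifted primes mean value Hildebrand"
(local 7 + s2/zbmath/crossref 30:
Hildebrand1989, Indlekofer–Timofeev 1998/2001/2002, Stepanauskas 1997, Timofeev 1991/1994, Sachpazis
2021 arXiv:2104.03358 READ pp.1–3 —
positive f, value tuples, not means; Pollack 2019 Glasgow; Elliott 1999 Acta Arith.); lit search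
--source zbmath with reviews (Hildebrand1989:
"partial analog of Halász' mean value theorem"; Timofeev 1994 zbl:0941.11036: asymptotics of means
of complex |f| ≤ 1 on shifted primes =
"the main open problem in this area"); lit galaxy search "two-constants theorem" --star all (10
rows: complex-analysis texts, Grujić NSE
sparseness arXiv:1111.0217 — no number theory); lit vsearch ×2 (two-constants/harmonic measure for Σ
z^Ω; Brun–Titchmarsh for f(p+a)) —
nothing on the mechanism; lit read Ransford1995 (Thm 4.3.7 Two-Constant PDF p.80, Thm 4.5.1
Poisson–Jensen PDF p.92), Elliott1997 (Duality,
grep: shifted primes only via additive functions ch. 33); lit frontier Parity --since 2021 (30 rows)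
and lit bridges Parity --cross any
(30 rows): none on multiplicative functions at shifted primes or harmonic measure; all 7 Theses of
the sub-problem and the cards
parity-is-torsion, lee-yang-circle-prime-factors (zeros of the same polynomials — values vs zeros),
katai-propagation-shifted-primes,
rough-pair-signature-polynomial, parity-corner-vitali read; ledger negatives --problem Parity: 0.
OpenAlex/arXiv APIs rate-limited (rec  [refs: 10.1112/plms/s3-59.2.209, 10.1007/978-1-4757-4507-8_9, 2104.03358, 1111.0217, doi:10.1112/plms/s3-59.2.209, doi:10.1007/978-1-4757-4507-8_9, Hildebrand1989, Ransford1995, Elliott1997, Selberg1954, Tenenbaum2015]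

Barriers (technique_class: harmonic-measure pretentious shifted-primes): - technique_class: harmonic-measure pretentious shifted-primes
- Literature.Barriers.Parity.SelbergParityBarrier: not met — no Type-I/sieve deduction of the atom
is claimed; the decisive input ArcSaving is parity-SENSITIVE (Selberg's ghost world λ(p+h) ≡ −1
forces |S(θ)| ≈ π(x)(log x)^{−1−cos θ}, large exactly on arcs near π, violating ArcSaving where the
budget needs it), and the sieve enters only through the UPPER bound ShiftedPrimeGrowth, which parity
permits.
- Literature.Barriers.Parity.PrimePairParity: the weight-insertion test — inserting 1 ± λ(p+h) flips
P_x(−1) AND changes P_x on the arc; the deduction is not weight-insertion invariant, consistent with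
the barrier.
- Literature.Barriers.Parity.MatomakiRadziwillTao2015_counterexample: respected — g_θ = e^{iθΩ} has
g_θ(p) ≡ e^{iθ}, distance² to every χ(n)n^{it}, |t| ≤ x, is ≫ (1−cos θ)loglog x uniformly, so
ArcSaving is stated for an explicit uniformly non-pretentious family, never for the
pointwise-non-pretentious class the counterexample kills.
- Literature.Barriers.Parity.LogarithmicAveraging: not met — all sums are Cesàro in p; nothing is
log-averaged or transferred from log-averages.
- Literature.Barriers.Parity.SiegelZeroTwinPrimes: fixed h throughout; at illusory (Siegel) scales λ
≈ χ modulates S(θ) and the atom together, and the conclusion is the fixed-shift atom, not a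
shift-uniform statement; constants are ineffective as in every Halász-type input — conceded, not
evaded.
- Literature.Barriers.Parity.FordMayna

Novelty grade: new-combination — REVIEW (refuter rreview g2, 08-15). STRUCTURE: retired correctly (D-0027 §2.1; route-repair planner concurred 14:03Z): Assembly ends at MoebiusShiftedPrimesConjecture (m=1 atom), not GHL; continuation needs EH ∧ M_avg (retired MobiusShiftedPrimes) ⇒ no conforming re-filing by bookkeeping. ELABORATIO (refuter refuter-rreview-route-Schanuel-Exception-0816cb8f-g2-0, 2026-08-15T14:16:11Z; prior: Ransford1995, Hildebrand1989, zbl:0941.11036, Pollack2019)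

History (route lifecycle, newest last):
- 2026-08-15T13:49:09Z · CLOSED retired — not-a-thesis: assembly does not conclude the sub-problem Statement (operator:999:1257524)
- 2026-08-15T14:03:21Z · CLOSED retired — not-a-thesis: assembly concludes MoebiusShiftedPrimesConjecture, not GeneralizedHardyLittlewood (route-repair confirms operator audit; cone debt is structural, see note) (planner-Parity-route-Parity-AntipodeTransport-0)

sub-problem: GeneralizedHardyLittlewood · status: closed(retired) · opened planner-plancard-Parity-GeneralizedHardyLittl-a6ffd2d9-0 2026-08-15T12:19:39Z · rev 0 · ledger route-Parity-AntipodeTransport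
GENERATED by the gate from the ledger (D-0016/17). Provers cite these decls: `theorem foo : Summit.Parity.GeneralizedHardyLittlewood.Theses.AntipodeTransport.<Decl> := …` in Summits/Parity/GeneralizedHardyLittlewood/Theorems/<Name>.lean.
-/

namespace Summit.Parity.GeneralizedHardyLittlewood.Theses.AntipodeTransport

open scoped BigOperators Topology Manifold Classical MeasureTheory ProbabilityTheory Matrix InnerProductSpace ComplexConjugate ContinuousMap
open Filter Set Function TopologicalSpace MeasureTheory

attribute [summit_statement] _root_.GeneralizedHardyLittlewood

/-- item stmt-Parity-7908 · crux · rank 2 · closed · moot by None · by planner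
why it might fail: At each fixed θ it is a log-power Type-II problem for g_θ=e^{iθΩ} on mn+h — λ's own species (Vaughan: BV part fine, bilinear part = 2-point Elliott on rank-one AP families); Hildebrand's method gives only 1−δ; duality in θ alone saves only √loglog x (Parseval).
sources: Hildebrand1989, Elliott1997, zbl:0941.11036, doi:10.1007/978-1-4757-4507-8_9, MatomakiRadziwillTao2015, Lichtman2020
[crux] card Crux 1 in progressions: for every h ≥ 1, q ≥ 1, a there exist 0 < θ₁ < θ₀ < π, c > 0
with c(tan(θ₀/2) − tan(θ₁/2)) > π and x₀ such that for x ≥ x₀ and all θ ∈ [θ₁, θ₀], |Σ_{p≤x, p≡a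
(q)} e^{iθΩ(p+h)}| ≤ π(x)(log x)^{−c} (model: ≍ π(x)(log x)^{cos θ−1}/φ(q), so any c below 1 − cos
θ₁ is consistent; e.g. saving (log x)^{−0.06} on [0.9π, 0.99π], or (log x)^{−1} on [π/2, 0.85π]).
[difficulty: open-problem] -/
@[route_item "route-Parity-AntipodeTransport"]
def ArcSaving : Prop :=
  ∀ h : ℕ, 1 ≤ h → ∀ q : ℕ, 1 ≤ q → ∀ a : ℕ, ∃ θ₁ θ₀ c : ℝ, 0 < θ₁ ∧ θ₁ < θ₀ ∧ θ₀ < Real.pi ∧ 0 < c ∧ Real.pi < c * (Real.tan (θ₀ / 2) - Real.tan (θ₁ / 2)) ∧ ∃ x₀ : ℕ, ∀ x : ℕ, x₀ ≤ x → ∀ θ : ℝ, θ₁ ≤ θ → θ ≤ θ₀ → ‖∑ p ∈ (Nat.primesLE x).filter (fun p : ℕ => p ≡ a [MOD q]), Complex.exp (Complex.I * (θ : ℂ) * ((ArithmeticFunction.cardFactors (p + h) : ℕ) : ℂ))‖ ≤ (Nat.primeCounting x : ℝ) * Real.log x ^ (-c)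

/-- item stmt-Parity-7909 · crux · rank 3 · closed · moot by None · by planner
why it might fail: Even o(π(x)) at a single fixed angle is open (Timofeev 1994: the main open problem); a rate needs Halász over shifted primes, i.e. Type-II sums Σα_mβ_n e^{iθΩ(mn+h)} with log-power saving, known only on average over h (Lichtman/MRT) or log-averaged.
sources: Hildebrand1989, zbl:0941.11036, doi:10.1007/bf02465584, Lichtman2020, Tao2016
[crux] log-power Hildebrand at ONE non-torsion angle (the first waypoint; not used by the Assembly):
for every h ≥ 1 and every θ with θ/π irrational there are c > 0, x₀ with |Σ_{p≤x} e^{iθΩ(p+h)}| ≤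
π(x)(log x)^{−c} for x ≥ x₀ (Hildebrand1989, a partial Halász analogue on p+1, gives at best |Σ_p
g(p+1)| ≤ (1−δ)π(x) under a hypothesis of non-torsion type on the powers of g — exact hypotheses to
be page-verified by the grounder, paper paywalled this session, acq-02496; g_θ = e^{iθΩ} with θ/π
irrational has all powers non-pretentious; torsion angles — cubic parity etc. — are deliberately
excluded). [difficulty: open-problem] -/
@[route_item "route-Parity-AntipodeTransport"]
def SingleAngleSaving : Prop :=
  ∀ h : ℕ, 1 ≤ h → ∀ θ : ℝ, Irrational (θ / Real.pi) → ∃ c : ℝ, 0 < c ∧ ∃ x₀ : ℕ, ∀ x : ℕ, x₀ ≤ x → ‖∑ p ∈ Nat.primesLE x, Complex.exp (Complex.I * (θ : ℂ) * ((ArithmeticFunction.cardFactors (p + h) : ℕ) : ℂ))‖ ≤ (Nat.primeCounting x : ℝ) * Real.log x ^ (-c)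

/-- item stmt-Parity-7910 · support · rank 9 · closed · moot by None · by planner
sources: Ransford1995, AhlforsCA1979
[support] the transport lemma, pure complex analysis (card Crux 2 with the sharp budget): for 0 < θ₁
< θ₀ < π, c > 0 with c(tan(θ₀/2) − tan(θ₁/2)) > π there are δ ∈ (0, 1/2], η > 0 and, for every B, an
L₀ such that every polynomial P ∈ ℂ[z] with |P| ≤ 1 on |z| = 1, |P(e^{±iθ})| ≤ L^{−c} for θ ∈ [θ₁,
θ₀] and |P(z)| ≤ B·L^{|z|−1} for 1 ≤ |z| ≤ 1+δ satisfies |P(−1)| ≤ L^{−η} (L ≥ L₀). Proof (NOTES):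
Poisson–Jensen in 𝔻 gives log|P(z)| ≤ −c(log L)·ω(z, A, 𝔻) with ω(−1+ρe^{iα}) ≥ ρ(2cos α − ρ)(κ/2)(1
− O(ρ)), κπ = tan(θ₀/2) − tan(θ₁/2); the sub-mean-value inequality on |z+1| = ρ = δ then gives
log|P(−1)| ≤ (ρ/π)(1 − cκ + O(ρ))log L + log⁺B. [difficulty: L] -/
@[route_item "route-Parity-AntipodeTransport"]
def TwoConstantsTransport : Prop :=
  ∀ θ₁ θ₀ c : ℝ, 0 < θ₁ → θ₁ < θ₀ → θ₀ < Real.pi → 0 < c → Real.pi < c * (Real.tan (θ₀ / 2) - Real.tan (θ₁ / 2)) → ∃ δ : ℝ, 0 < δ ∧ δ ≤ 1 / 2 ∧ ∃ η : ℝ, 0 < η ∧ ∀ B : ℝ, ∃ L₀ : ℝ, ∀ L : ℝ, L₀ ≤ L → ∀ P : Polynomial ℂ, (∀ z : ℂ, ‖z‖ = 1 → ‖P.eval z‖ ≤ 1) → (∀ θ : ℝ, θ₁ ≤ θ → θ ≤ θ₀ → ‖P.eval (Complex.exp (Complex.I * (θ : ℂ)))‖ ≤ L ^ (-c) ∧ ‖P.eval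 (Complex.exp (-(Complex.I * (θ : ℂ))))‖ ≤ L ^ (-c)) → (∀ z : ℂ, 1 ≤ ‖z‖ → ‖z‖ ≤ 1 + δ → ‖P.eval z‖ ≤ B * L ^ (‖z‖ - 1)) → ‖P.eval (-1)‖ ≤ L ^ (-η)

/-- item stmt-Parity-7911 · support · rank 9 · closed · moot by None · by planner
sources: Shiu1980, Pollack2019, NairTenenbaum1998, Tenenbaum2015
[support] Brun–Titchmarsh for y^Ω on shifted primes, uniform in 1 ≤ y ≤ 3/2 (card's growth input):
for every h ≥ 1 there are B, x₀ with Σ_{p≤x} y^{Ω(p+h)} ≤ B·π(x)(log x)^{y−1} for all x ≥ x₀, 1 ≤ y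
≤ 3/2. Known theorem (Shiu-type bound over the sifted set {m ≤ x+h : m − h prime}: ≪ (x/log x)(1/log
x)exp(Σ_{ℓ≤x} y/ℓ); Pollack 2020 Thm 1.1 / Nair–Tenenbaum / Timofeev's Hardy–Ramanujan inequality
for shifted primes); Lean route: the in-tree PROVED Shiu1980BrunTitchmarsh_holds adapted to one
removed class per prime, or Mathlib/in-tree Selberg upper-bound sieve
(siftedSum_le_totalMass_div_selbergSum_add_holds) with Shiu for y^Ω in progressions. [difficulty: L] -/
@[route_item "route-Parity-AntipodeTransport"]
def ShiftedPrimeGrowth : Prop :=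
  ∀ h : ℕ, 1 ≤ h → ∃ B : ℝ, ∃ x₀ : ℕ, ∀ x : ℕ, x₀ ≤ x → ∀ y : ℝ, 1 ≤ y → y ≤ 3 / 2 → ∑ p ∈ Nat.primesLE x, y ^ (ArithmeticFunction.cardFactors (p + h) : ℕ) ≤ B * (Nat.primeCounting x : ℝ) * Real.log x ^ (y - 1)

/-- item stmt-Parity-7912 · support · rank 9 · closed · moot by None · by planner
sources: Ransford1995, Vatwani2016
[support] instantiation glue: ArcSaving → TwoConstantsTransport → ShiftedPrimeGrowth → for every h ≥
1, q ≥ 1, a there is η > 0 with |Σ_{p≤x, p≡a (q)} λ(p+h)| ≤ π(x)(log x)^{−η} for large x. Proof: P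
:= π(x)^{−1}Σ_{p≤x, p≡a (q)} X^{Ω(p+h)} ∈ ℝ_{≥0}[X], L := log x; |P| ≤ P(1) ≤ 1 on the circle; the
arc bound at −θ is the complex conjugate; the graded growth follows from ShiftedPrimeGrowth with y =
|z| after dropping the congruence by positivity; P(−1) = π(x)^{−1}Σ (−1)^{Ω(p+h)} = π(x)^{−1}Σ
λ(p+h). [difficulty: M] -/
@[route_item "route-Parity-AntipodeTransport"]
def LiouvilleAtomAP : Prop :=
  ArcSaving → TwoConstantsTransport → ShiftedPrimeGrowth → ∀ h : ℕ, 1 ≤ h → ∀ q : ℕ, 1 ≤ q → ∀ a : ℕ, ∃ η : ℝ, 0 < η ∧ ∃ x₀ : ℕ, ∀ x : ℕ, x₀ ≤ x → |∑ p ∈ (Nat.primesLE x).filter (fun p : ℕ => p ≡ a [MOD q]), (ArithmeticFunction.liouville (p + h) : ℝ)| ≤ (Nat.primeCounting x : ℝ) * Real.log x ^ (-η)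

/-- item stmt-Parity-7913 · support · rank 9 · closed · moot by None · by planner
sources: Lichtman2020, MurtyVatwani2017, Vatwani2016
[support] squarefree-sieve glue: if Σ_{p≤x, p≡a (q)} λ(p+h) = o(π(x)) for all h ≥ 1, q ≥ 1, a, then
MoebiusShiftedPrimesConjecture. Proof: μ(n) = λ(n)Σ_{k²∣n} μ(k); Σ_{p≤X} μ(p+h) = Σ_{k≤K} μ(k)
Σ_{p≤X, p≡−h (k²)} λ(p+h) + O(Σ_{k>K} #{p ≤ X : k² ∣ p+h}); each k ≤ K term is o(π(X)) by
hypothesis; the tail is ≪ π(X)/K + X^{3/4} by Brun–Titchmarsh (in tree, proved: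
Literature.Barriers.Parity.colCount_le_brunTitchmarsh / card_roughAP_le) for k ≤ X^{1/4} and
trivially beyond; let K → ∞. [difficulty: M] -/
@[route_item "route-Parity-AntipodeTransport"]
def LiouvilleToMoebius : Prop :=
  (∀ h : ℕ, 1 ≤ h → ∀ q : ℕ, 1 ≤ q → ∀ a : ℕ, (fun x : ℕ => ∑ p ∈ (Nat.primesLE x).filter (fun p : ℕ => p ≡ a [MOD q]), (ArithmeticFunction.liouville (p + h) : ℝ)) =o[Filter.atTop] fun x : ℕ => (Nat.primeCounting x : ℝ)) → Literature.NumberTheory.Sieve.MoebiusShiftedPrimesConjecture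

/-- item stmt-Parity-7914 · assembly · rank 1 · closed · moot by None · by planner
sources: Lichtman2020, Ransford1995, Hildebrand1989
[assembly] ArcSaving → TwoConstantsTransport → ShiftedPrimeGrowth → MoebiusShiftedPrimesConjecture
(the route's terminal atom; see the paragraph above for why it is not the sub-problem statement). -/
@[route_item "route-Parity-AntipodeTransport"]
def Assembly : Prop :=
  ArcSaving → TwoConstantsTransport → ShiftedPrimeGrowth → Literature.NumberTheory.Sieve.MoebiusShiftedPrimesConjecture

end Summit.Parity.GeneralizedHardyLittlewood.Theses.AntipodeTransport
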